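import Summits.CriticalPhenomena.PercolationContinuityZ3.Theses.PercFiniteBoxLRO
import Summits.CriticalPhenomena.PercolationContinuityZ3.Theses.PercHollowCells
import Summits.CriticalPhenomena.PercolationContinuityZ3.Theses.PercHyperscalingGluing
import Summits.CriticalPhenomena.PercolationContinuityZ3.Theses.PercNonProliferation
import Summits.CriticalPhenomena.PercolationContinuityZ3.Theses.PercRayRenewal
import Summits.CriticalPhenomena.PercolationContinuityZ3.Theses.PercOpenSupercrit
import Summits.CriticalPhenomena.PercolationContinuityZ3.Theorems.PercFiniteBoxLRORenormaliseFromLinearLROTwoArmsFrontier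
import Summits.CriticalPhenomena.PercolationContinuityZ3.Theorems.PercFiniteBoxLRORenormaliseFromLinearLRONoGoodBoxAtPc

/-!
# Crux `PercFiniteBoxLRO.RenormaliseFromLinearLRO` (stmt-CriticalPhenomena-0857), line `registered`, lead cycle 4 —
# CROSS-ROUTE ANATOMY: the crux follows from each of five EXISTING items of sibling routes

By `stub_cruxIffNotLinearLROAtPc` (p152652) the crux R is `¬LRO_lin(p_c)`: no `ρ > 0`, `K` with
`P_{p_c}(x ↔ y inside Λ(Kn)) ≥ ρ` for all `n ≥ 1`, `x, y ∈ Λ(n)`.  Linear-scale finite-box LRO at `p_c` is a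
FREE-BOX statement (connections inside `Λ(Kn)` are connections in the free box `Λ(Kn)`), and it gives the free box
`Λ((K+1)n)` a centre cluster / pair density `≥ ρ/(K+1)³` / `≥ ρ/(K+1)⁶` at EVERY scale `n`
(`sum_real_openConnIn_ge_of_linearLRO`, `sum_sum_real_openConnIn_ge_of_linearLRO`: restrict the sums to `Λ(n)`,
enlarge the box of the connection from `Λ(Kn)` to `Λ((K+1)n)`, `|Λ((K+1)n)| ≤ (K+1)³|Λ(n)|`).  Hence R follows from
each of the following items of OTHER routes of this sub-problem, kernel-checked here so that the planners can merge /
park the crux (three line leads found no attack on R below conjunct strength, `Lines/registered-dead.md`):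

* `renormaliseFromLinearLRO_of_freeBoxShattering` — from `PercHollowCells.FreeBoxShattering` (stmt-5836), Hutchcroft's
  free-box shattering "folklore" `|Λ_L|⁻¹ E_{p_c}|C_{Λ_L}(0)| → 0` (arXiv:2202.07634 p.5, asserted without proof);
* `renormaliseFromLinearLRO_of_freeBoxShattering'` — from `PercHyperscalingGluing.FreeBoxShattering` (stmt-4644), the
  same statement normalised by `|Λ_r|`;
* `renormaliseFromLinearLRO_of_freeBoxSparse` — from `PercNonProliferation.FreeBoxSparse` (stmt-4445), the pair-averaged
  form `|Λ_n|⁻² Σ_{x,y} P_{p_c}(x ↔ y inside Λ_n) → 0`;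
* `renormaliseFromLinearLRO_of_twoArmsRatioExponent` — from `PercRayRenewal.TwoArmsRatioExponent` (stmt-4625), a box
  two-arms RATIO exponent `> 1` at `p_c`, via the landed frontier of this line (`linearTwoArms_littleO_of_exponent` +
  `renormaliseFromLinearLRO_of_linearTwoArms_littleO`, p167450) — this input even gives the conjunct;
* `renormaliseFromLinearLRO_of_goodBoxesLikely` — from `PercOpenSupercrit.GoodBoxesLikelyWhenPercolating` (stmt-3826),
  via `θ(p_c) ≥ ρ` (`le_theta_of_linearLRO`) and the landed "no good boxes at `p_c`" (`real_goodBox_criticalProbI_le`,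
  p152405, itself the same-`p` criterion stmt-3840 proved in p151477 + continuity).

All five are unconditional implications between statements already filed in the tree; nothing new is assumed.
Lands `--supports stmt-CriticalPhenomena-0857`.
-/

noncomputable section

namespace Summit.CriticalPhenomena.PercolationContinuityZ3.Theorems.RenormaliseFromLinearLRO

open Literature.Probability.Percolation Literature.Probability.LatticeModels
open MeasureTheory Filter Topology
open Summit.CriticalPhenomena.PercolationContinuityZ3.Theses

/-! ## Free-box densities forced by linear-scale finite-box LRO -/

/-- `|Λ((K+1)n)| ≤ (K+1)³ |Λ(n)|` in the form `(2(K+1)n + 1)³ ≤ (K+1)³ (2n+1)³`. -/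
theorem card_box_succ_mul_le (K n : ℕ) :
    (2 * (((K + 1) * n : ℕ) : ℝ) + 1) ^ 3 ≤ ((K : ℝ) + 1) ^ 3 * (2 * (n : ℝ) + 1) ^ 3 := by
  rw [← mul_pow]
  have hK : (0 : ℝ) ≤ K := Nat.cast_nonneg K
  have hn : (0 : ℝ) ≤ n := Nat.cast_nonneg n
  have hle : 2 * (((K + 1) * n : ℕ) : ℝ) + 1 ≤ ((K : ℝ) + 1) * (2 * (n : ℝ) + 1) := by
    push_cast; nlinarith
  exact pow_le_pow_left₀ (by positivity) hle 3

/-- **Centre density of the free box under `LRO_lin`.**  If `P_p(x ↔ y inside Λ(Kn)) ≥ ρ` for all `n ≥ 1` and all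
`x, y ∈ Λ(n)`, then for every `n ≥ 1` the free box `Λ((K+1)n)` has `Σ_{x ∈ Λ((K+1)n)} P_p(0 ↔ x inside Λ((K+1)n))
≥ ρ·|Λ(n)|` (restrict to `x ∈ Λ(n)` and enlarge the box of the connection, `openConnIn_mono`). -/
theorem sum_real_openConnIn_ge_of_linearLRO (p : unitInterval) {ρ : ℝ} {K : ℕ}
    (h : ∀ n : ℕ, 1 ≤ n → ∀ x ∈ box 3 n, ∀ y ∈ box 3 n,
      ρ ≤ (bondPercolation (zdGraph 3) p).real (openConnIn ↑(box 3 (K * n)) x y))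
    {n : ℕ} (hn : 1 ≤ n) :
    ρ * ((box 3 n).card : ℝ) ≤
      ∑ x ∈ box 3 ((K + 1) * n), (bondPercolation (zdGraph 3) p).real (openConnIn ↑(box 3 ((K + 1) * n)) 0 x) := by
  have hKn : K * n ≤ (K + 1) * n := Nat.mul_le_mul_right n (Nat.le_succ K)
  have hnKn : n ≤ (K + 1) * n := Nat.le_mul_of_pos_left n (Nat.succ_pos K)
  have hsub : box 3 n ⊆ box 3 ((K + 1) * n) := box_mono 3 hnKn
  have hcoe : (↑(box 3 (K * n)) : Set (Site 3)) ⊆ ↑(box 3 ((K + 1) * n)) :=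
    Finset.coe_subset.2 (box_mono 3 hKn)
  calc ρ * ((box 3 n).card : ℝ) = ∑ _x ∈ box 3 n, ρ := by
        rw [Finset.sum_const, nsmul_eq_mul, mul_comm]
    _ ≤ ∑ x ∈ box 3 n, (bondPercolation (zdGraph 3) p).real (openConnIn ↑(box 3 ((K + 1) * n)) 0 x) :=
        Finset.sum_le_sum fun x hx =>
          (h n hn 0 (zero_mem_box 3 n) x hx).trans (measureReal_mono (openConnIn_mono hcoe 0 x))
    _ ≤ ∑ x ∈ box 3 ((K + 1) * n), (bondPercolation (zdGraph 3) p).real (openConnIn ↑(box 3 ((K + 1) * n)) 0 x) :=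
        Finset.sum_le_sum_of_subset_of_nonneg hsub fun _ _ _ => measureReal_nonneg

/-- **Pair density of the free box under `LRO_lin`.**  Under the same hypothesis, for every `n ≥ 1`,
`Σ_{x, y ∈ Λ((K+1)n)} P_p(x ↔ y inside Λ((K+1)n)) ≥ ρ·|Λ(n)|²`. -/
theorem sum_sum_real_openConnIn_ge_of_linearLRO (p : unitInterval) {ρ : ℝ} {K : ℕ}
    (h : ∀ n : ℕ, 1 ≤ n → ∀ x ∈ box 3 n, ∀ y ∈ box 3 n,
      ρ ≤ (bondPercolation (zdGraph 3) p).real (openConnIn ↑(box 3 (K * n)) x y))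
    {n : ℕ} (hn : 1 ≤ n) :
    ρ * ((box 3 n).card : ℝ) ^ 2 ≤
      ∑ x ∈ box 3 ((K + 1) * n), ∑ y ∈ box 3 ((K + 1) * n),
        (bondPercolation (zdGraph 3) p).real (openConnIn ↑(box 3 ((K + 1) * n)) x y) := by
  have hKn : K * n ≤ (K + 1) * n := Nat.mul_le_mul_right n (Nat.le_succ K)
  have hnKn : n ≤ (K + 1) * n := Nat.le_mul_of_pos_left n (Nat.succ_pos K)
  have hsub : box 3 n ⊆ box 3 ((K + 1) * n) := box_mono 3 hnKn
  have hcoe : (↑(box 3 (K * n)) : Set (Site 3)) ⊆ ↑(box 3 ((K + 1) * n)) :=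
    Finset.coe_subset.2 (box_mono 3 hKn)
  calc ρ * ((box 3 n).card : ℝ) ^ 2 = ∑ _x ∈ box 3 n, ∑ _y ∈ box 3 n, ρ := by
        rw [Finset.sum_const, Finset.sum_const, nsmul_eq_mul, nsmul_eq_mul]; ring
    _ ≤ ∑ x ∈ box 3 n, ∑ y ∈ box 3 n,
          (bondPercolation (zdGraph 3) p).real (openConnIn ↑(box 3 ((K + 1) * n)) x y) :=
        Finset.sum_le_sum fun x hx => Finset.sum_le_sum fun y hy =>
          (h n hn x hx y hy).trans (measureReal_mono (openConnIn_mono hcoe x y))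
    _ ≤ ∑ x ∈ box 3 n, ∑ y ∈ box 3 ((K + 1) * n),
          (bondPercolation (zdGraph 3) p).real (openConnIn ↑(box 3 ((K + 1) * n)) x y) :=
        Finset.sum_le_sum fun x _ =>
          Finset.sum_le_sum_of_subset_of_nonneg hsub fun _ _ _ => measureReal_nonneg
    _ ≤ ∑ x ∈ box 3 ((K + 1) * n), ∑ y ∈ box 3 ((K + 1) * n),
          (bondPercolation (zdGraph 3) p).real (openConnIn ↑(box 3 ((K + 1) * n)) x y) :=
        Finset.sum_le_sum_of_subset_of_nonneg hsub fun _ _ _ =>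
          Finset.sum_nonneg fun _ _ => measureReal_nonneg

/-- **`LRO_lin(p)` bounds the free-box centre density below at every scale**: with `K' = K + 1`, for all `n ≥ 1`,
`ρ / K'³ ≤ |Λ(K'n)|⁻¹ Σ_{x ∈ Λ(K'n)} P_p(0 ↔ x inside Λ(K'n))` (written with `|Λ(L)| = (2L+1)³`). -/
theorem freeBoxDensity_ge_of_linearLRO (p : unitInterval) {ρ : ℝ} {K : ℕ} (hρ : 0 ≤ ρ)
    (h : ∀ n : ℕ, 1 ≤ n → ∀ x ∈ box 3 n, ∀ y ∈ box 3 n,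
      ρ ≤ (bondPercolation (zdGraph 3) p).real (openConnIn ↑(box 3 (K * n)) x y))
    {n : ℕ} (hn : 1 ≤ n) :
    ρ / ((K : ℝ) + 1) ^ 3 ≤
      (∑ x ∈ box 3 ((K + 1) * n), (bondPercolation (zdGraph 3) p).real (openConnIn ↑(box 3 ((K + 1) * n)) 0 x)) /
        (2 * (((K + 1) * n : ℕ) : ℝ) + 1) ^ 3 := by
  have hS := sum_real_openConnIn_ge_of_linearLRO p h hn
  have hcard : ((box 3 n).card : ℝ) = (2 * (n : ℝ) + 1) ^ 3 := by
    rw [card_box]; push_cast; ring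
  rw [hcard] at hS
  have hD := card_box_succ_mul_le K n
  have hDpos : (0 : ℝ) < (2 * (((K + 1) * n : ℕ) : ℝ) + 1) ^ 3 := by positivity
  have hB : (0 : ℝ) < (2 * (n : ℝ) + 1) ^ 3 := by positivity
  calc ρ / ((K : ℝ) + 1) ^ 3 = ρ * (2 * (n : ℝ) + 1) ^ 3 / (((K : ℝ) + 1) ^ 3 * (2 * (n : ℝ) + 1) ^ 3) := by
        rw [mul_div_mul_right _ _ hB.ne']
    _ ≤ ρ * (2 * (n : ℝ) + 1) ^ 3 / (2 * (((K + 1) * n : ℕ) : ℝ) + 1) ^ 3 :=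
        div_le_div_of_nonneg_left (by positivity) hDpos hD
    _ ≤ _ := div_le_div_of_nonneg_right hS hDpos.le

/-- **`LRO_lin(p)` bounds the free-box pair density below at every scale**: with `K' = K + 1`, for all `n ≥ 1`,
`ρ / K'⁶ ≤ |Λ(K'n)|⁻² Σ_{x, y ∈ Λ(K'n)} P_p(x ↔ y inside Λ(K'n))`. -/
theorem freeBoxPairDensity_ge_of_linearLRO (p : unitInterval) {ρ : ℝ} {K : ℕ} (hρ : 0 ≤ ρ)
    (h : ∀ n : ℕ, 1 ≤ n → ∀ x ∈ box 3 n, ∀ y ∈ box 3 n,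
      ρ ≤ (bondPercolation (zdGraph 3) p).real (openConnIn ↑(box 3 (K * n)) x y))
    {n : ℕ} (hn : 1 ≤ n) :
    ρ / (((K : ℝ) + 1) ^ 3) ^ 2 ≤
      (∑ x ∈ box 3 ((K + 1) * n), ∑ y ∈ box 3 ((K + 1) * n),
          (bondPercolation (zdGraph 3) p).real (openConnIn ↑(box 3 ((K + 1) * n)) x y)) /
        ((box 3 ((K + 1) * n)).card : ℝ) ^ 2 := by
  have hS := sum_sum_real_openConnIn_ge_of_linearLRO p h hn
  have hcard : ((box 3 n).card : ℝ) = (2 * (n : ℝ) + 1) ^ 3 := by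
    rw [card_box]; push_cast; ring
  have hcard' : ((box 3 ((K + 1) * n)).card : ℝ) = (2 * (((K + 1) * n : ℕ) : ℝ) + 1) ^ 3 := by
    rw [card_box]; push_cast; ring
  rw [hcard] at hS
  rw [hcard']
  have hD : ((2 * (((K + 1) * n : ℕ) : ℝ) + 1) ^ 3) ^ 2 ≤ (((K : ℝ) + 1) ^ 3) ^ 2 * ((2 * (n : ℝ) + 1) ^ 3) ^ 2 := by
    rw [← mul_pow]
    exact pow_le_pow_left₀ (by positivity) (card_box_succ_mul_le K n) 2
  have hDpos : (0 : ℝ) < ((2 * (((K + 1) * n : ℕ) : ℝ) + 1) ^ 3) ^ 2 := by positivity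
  have hB : (0 : ℝ) < ((2 * (n : ℝ) + 1) ^ 3) ^ 2 := by positivity
  calc ρ / (((K : ℝ) + 1) ^ 3) ^ 2
        = ρ * ((2 * (n : ℝ) + 1) ^ 3) ^ 2 / ((((K : ℝ) + 1) ^ 3) ^ 2 * ((2 * (n : ℝ) + 1) ^ 3) ^ 2) := by
        rw [mul_div_mul_right _ _ hB.ne']
    _ ≤ ρ * ((2 * (n : ℝ) + 1) ^ 3) ^ 2 / ((2 * (((K + 1) * n : ℕ) : ℝ) + 1) ^ 3) ^ 2 :=
        div_le_div_of_nonneg_left (by positivity) hDpos hD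
    _ ≤ _ := div_le_div_of_nonneg_right hS hDpos.le

/-! ## R from the free-box shattering / sparseness items -/

/-- **`¬LRO_lin(p_c)` from free-box shattering (stmt-5836 shape).**  If `|Λ_L|⁻¹ Σ_{x ∈ Λ_L} P_{p_c}(0 ↔ x inside Λ_L)
→ 0` then there is no linear-scale finite-box LRO at `p_c`: under `LRO_lin(p_c)` with ratio `K` the density along
`L = (K+1)n` stays `≥ ρ/(K+1)³`. -/
theorem not_linearLRO_criticalProbI_of_freeBoxShattering (hF : PercHollowCells.FreeBoxShattering) :
    ¬ (∃ ρ : ℝ, 0 < ρ ∧ ∃ K : ℕ, ∀ n : ℕ, 1 ≤ n → ∀ x ∈ box 3 n, ∀ y ∈ box 3 n,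
        ρ ≤ (bondPercolation (zdGraph 3) (criticalProbI 3)).real (openConnIn ↑(box 3 (K * n)) x y)) := by
  rintro ⟨ρ, hρ, K, hK⟩
  have hc : 0 < ρ / ((K : ℝ) + 1) ^ 3 := by positivity
  obtain ⟨L₀, hL₀⟩ := eventually_atTop.1 (hF.eventually (gt_mem_nhds hc))
  have hn : 1 ≤ L₀ + 1 := Nat.le_add_left 1 L₀
  have hL : L₀ ≤ (K + 1) * (L₀ + 1) :=
    (Nat.le_succ L₀).trans (Nat.le_mul_of_pos_left _ (Nat.succ_pos K))
  have hlt := hL₀ ((K + 1) * (L₀ + 1)) hL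
  have hge := freeBoxDensity_ge_of_linearLRO (criticalProbI 3) hρ.le hK hn
  exact absurd hge (not_le.2 hlt)

/-- **The crux BY NAME from `PercHollowCells.FreeBoxShattering` (stmt-CriticalPhenomena-5836).** -/
theorem renormaliseFromLinearLRO_of_freeBoxShattering (hF : PercHollowCells.FreeBoxShattering) :
    PercFiniteBoxLRO.RenormaliseFromLinearLRO :=
  renormaliseFromLinearLRO_of_not_linearLRO_criticalProbI (not_linearLRO_criticalProbI_of_freeBoxShattering hF)

/-- **`¬LRO_lin(p_c)` from free-box shattering, `|Λ_r|⁻¹`-normalised form (stmt-4644 shape).** -/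
theorem not_linearLRO_criticalProbI_of_freeBoxShattering' (hF : PercHyperscalingGluing.FreeBoxShattering) :
    ¬ (∃ ρ : ℝ, 0 < ρ ∧ ∃ K : ℕ, ∀ n : ℕ, 1 ≤ n → ∀ x ∈ box 3 n, ∀ y ∈ box 3 n,
        ρ ≤ (bondPercolation (zdGraph 3) (criticalProbI 3)).real (openConnIn ↑(box 3 (K * n)) x y)) := by
  rintro ⟨ρ, hρ, K, hK⟩
  have hc : 0 < ρ / ((K : ℝ) + 1) ^ 3 := by positivity
  obtain ⟨L₀, hL₀⟩ := eventually_atTop.1 (hF.eventually (gt_mem_nhds hc))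
  have hn : 1 ≤ L₀ + 1 := Nat.le_add_left 1 L₀
  have hL : L₀ ≤ (K + 1) * (L₀ + 1) :=
    (Nat.le_succ L₀).trans (Nat.le_mul_of_pos_left _ (Nat.succ_pos K))
  have hlt := hL₀ ((K + 1) * (L₀ + 1)) hL
  have hge := freeBoxDensity_ge_of_linearLRO (criticalProbI 3) hρ.le hK hn
  have hcard : ((box 3 ((K + 1) * (L₀ + 1))).card : ℝ) = (2 * (((K + 1) * (L₀ + 1) : ℕ) : ℝ) + 1) ^ 3 := by
    rw [card_box]; push_cast; ring
  rw [inv_mul_eq_div, hcard] at hlt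
  exact absurd hge (not_le.2 hlt)

/-- **The crux BY NAME from `PercHyperscalingGluing.FreeBoxShattering` (stmt-CriticalPhenomena-4644).** -/
theorem renormaliseFromLinearLRO_of_freeBoxShattering' (hF : PercHyperscalingGluing.FreeBoxShattering) :
    PercFiniteBoxLRO.RenormaliseFromLinearLRO :=
  renormaliseFromLinearLRO_of_not_linearLRO_criticalProbI (not_linearLRO_criticalProbI_of_freeBoxShattering' hF)

/-- **`¬LRO_lin(p_c)` from free-box sparseness (stmt-4445 shape).**  If the pair-averaged free-box connectivity
`|Λ_n|⁻² Σ_{x,y ∈ Λ_n} P_{p_c}(x ↔ y inside Λ_n) → 0` then there is no linear-scale finite-box LRO at `p_c`: under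
`LRO_lin(p_c)` with ratio `K` the pair density along `(K+1)n` stays `≥ ρ/(K+1)⁶`. -/
theorem not_linearLRO_criticalProbI_of_freeBoxSparse (hF : PercNonProliferation.FreeBoxSparse) :
    ¬ (∃ ρ : ℝ, 0 < ρ ∧ ∃ K : ℕ, ∀ n : ℕ, 1 ≤ n → ∀ x ∈ box 3 n, ∀ y ∈ box 3 n,
        ρ ≤ (bondPercolation (zdGraph 3) (criticalProbI 3)).real (openConnIn ↑(box 3 (K * n)) x y)) := by
  rintro ⟨ρ, hρ, K, hK⟩
  have hc : 0 < ρ / (((K : ℝ) + 1) ^ 3) ^ 2 := by positivity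
  obtain ⟨L₀, hL₀⟩ := eventually_atTop.1 (hF.eventually (gt_mem_nhds hc))
  have hn : 1 ≤ L₀ + 1 := Nat.le_add_left 1 L₀
  have hL : L₀ ≤ (K + 1) * (L₀ + 1) :=
    (Nat.le_succ L₀).trans (Nat.le_mul_of_pos_left _ (Nat.succ_pos K))
  have hlt := hL₀ ((K + 1) * (L₀ + 1)) hL
  have hge := freeBoxPairDensity_ge_of_linearLRO (criticalProbI 3) hρ.le hK hn
  exact absurd hge (not_le.2 hlt)

/-- **The crux BY NAME from `PercNonProliferation.FreeBoxSparse` (stmt-CriticalPhenomena-4445).** -/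
theorem renormaliseFromLinearLRO_of_freeBoxSparse (hF : PercNonProliferation.FreeBoxSparse) :
    PercFiniteBoxLRO.RenormaliseFromLinearLRO :=
  renormaliseFromLinearLRO_of_not_linearLRO_criticalProbI (not_linearLRO_criticalProbI_of_freeBoxSparse hF)

/-! ## R from a two-arms ratio exponent `> 1` -/

/-- A box two-arms RATIO exponent `> 1` at `p_c` (stmt-4625 shape: `P_{p_c}(A₂(r, n)) ≤ C (r/n)^c` for all
`1 ≤ r ≤ n`) gives the linear-scale exponent hypothesis of `linearTwoArms_littleO_of_exponent` (take `r = n`,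
`n ↦ K n`: `(n/(Kn))^c = K^{-c}`; the two event encodings agree). -/
theorem linearTwoArms_exponent_of_twoArmsRatioExponent (h : PercRayRenewal.TwoArmsRatioExponent) :
    ∃ γ : ℝ, 1 < γ ∧ ∃ C : ℝ, ∀ K : ℕ, 2 ≤ K → ∃ N : ℕ, ∀ n : ℕ, N ≤ n →
      (bondPercolation (zdGraph 3) (criticalProbI 3)).real
        {ω | ∃ x ∈ box 3 n, ∃ x' ∈ box 3 n,
          ∃ z ∈ innerBoundary (zdGraph 3) (box 3 (K * n)), ∃ z' ∈ innerBoundary (zdGraph 3) (box 3 (K * n)),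
            ω ∈ openConnIn ↑(box 3 (K * n)) x z ∧ ω ∈ openConnIn ↑(box 3 (K * n)) x' z' ∧
              ω ∉ openConnIn ↑(box 3 (K * n)) x x'} ≤ C * (K : ℝ) ^ (-γ) := by
  obtain ⟨c, C, hc, hall⟩ := h
  refine ⟨c, hc, C, fun K hK => ⟨1, fun n hn => ?_⟩⟩
  have hK1 : 1 ≤ K := le_trans (by norm_num) hK
  have hnKn : n ≤ K * n := Nat.le_mul_of_pos_left n (lt_of_lt_of_le Nat.zero_lt_one hK1)
  have hset :
      {ω : BondConfig (Site 3) | ∃ x ∈ box 3 n, ∃ x' ∈ box 3 n,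
          ∃ z ∈ innerBoundary (zdGraph 3) (box 3 (K * n)), ∃ z' ∈ innerBoundary (zdGraph 3) (box 3 (K * n)),
            ω ∈ openConnIn ↑(box 3 (K * n)) x z ∧ ω ∈ openConnIn ↑(box 3 (K * n)) x' z' ∧
              ω ∉ openConnIn ↑(box 3 (K * n)) x x'} =
        {ω | ∃ u ∈ box 3 n, ∃ v ∈ box 3 n,
          (∃ y ∈ innerBoundary (zdGraph 3) (box 3 (K * n)), ω ∈ openConnIn ↑(box 3 (K * n)) u y) ∧
            (∃ y ∈ innerBoundary (zdGraph 3) (box 3 (K * n)), ω ∈ openConnIn ↑(box 3 (K * n)) v y) ∧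
              ω ∉ openConnIn ↑(box 3 (K * n)) u v} := by
    ext ω
    simp only [Set.mem_setOf_eq]
    constructor
    · rintro ⟨x, hx, x', hx', z, hz, z', hz', h1, h2, h3⟩
      exact ⟨x, hx, x', hx', ⟨z, hz, h1⟩, ⟨z', hz', h2⟩, h3⟩
    · rintro ⟨x, hx, x', hx', ⟨z, hz, h1⟩, ⟨z', hz', h2⟩, h3⟩
      exact ⟨x, hx, x', hx', z, hz, z', hz', h1, h2, h3⟩
  rw [hset]
  refine (hall n (K * n) hn hnKn).trans (le_of_eq ?_)
  have hn0 : (n : ℝ) ≠ 0 := by exact_mod_cast (Nat.one_le_iff_ne_zero.1 hn)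
  have hK0 : (0 : ℝ) ≤ K := Nat.cast_nonneg K
  congr 1
  rw [Nat.cast_mul, mul_comm, ← div_div, div_self hn0, one_div, Real.inv_rpow hK0, Real.rpow_neg hK0]

/-- **The crux BY NAME from `PercRayRenewal.TwoArmsRatioExponent` (stmt-CriticalPhenomena-4625)**, through the landed
two-arms frontier of the line (p167450): exponent `> 1` ⇒ linear two-arms `o(1/K)` ⇒ `θ(p_c) = 0` ⇒ `¬LRO_lin(p_c)` ⇒ R. -/
theorem renormaliseFromLinearLRO_of_twoArmsRatioExponent (h : PercRayRenewal.TwoArmsRatioExponent) :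
    PercFiniteBoxLRO.RenormaliseFromLinearLRO :=
  renormaliseFromLinearLRO_of_linearTwoArms_littleO fun _ =>
    linearTwoArms_littleO_of_exponent (linearTwoArms_exponent_of_twoArmsRatioExponent h)

/-- The sub-problem's conjunct from `PercRayRenewal.TwoArmsRatioExponent` (recorded for the planners: this input is
conjunct-strength, `percolationContinuityZ3_of_linearTwoArms_littleO`). -/
theorem percolationContinuityZ3_of_twoArmsRatioExponent (h : PercRayRenewal.TwoArmsRatioExponent) :
    Literature.Probability.Percolation.PercolationContinuityZ3 :=
  percolationContinuityZ3_of_linearTwoArms_littleO fun _ =>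
    linearTwoArms_littleO_of_exponent (linearTwoArms_exponent_of_twoArmsRatioExponent h)

/-! ## R from "good boxes are likely when percolating" -/

/-- **`¬LRO_lin(p_c)` from `PercOpenSupercrit.GoodBoxesLikelyWhenPercolating` (stmt-3826 shape).**  `LRO_lin(p_c)`
gives `θ(p_c) ≥ ρ > 0` (`le_theta_of_linearLRO`), so the item would make some good box `G_n` more than
`(1 − δ)`-likely at `p_c` for the `δ` of `real_goodBox_criticalProbI_le` — which says no good box is. -/
theorem not_linearLRO_criticalProbI_of_goodBoxesLikely (hG : PercOpenSupercrit.GoodBoxesLikelyWhenPercolating) :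
    ¬ (∃ ρ : ℝ, 0 < ρ ∧ ∃ K : ℕ, ∀ n : ℕ, 1 ≤ n → ∀ x ∈ box 3 n, ∀ y ∈ box 3 n,
        ρ ≤ (bondPercolation (zdGraph 3) (criticalProbI 3)).real (openConnIn ↑(box 3 (K * n)) x y)) := by
  rintro ⟨ρ, hρ, K, hK⟩
  have hθ : 0 < theta (zdGraph 3) 0 (criticalProbI 3) := hρ.trans_le (le_theta_of_linearLRO _ hK)
  obtain ⟨δ, hδ, hle⟩ := real_goodBox_criticalProbI_le
  obtain ⟨n, hn, hgt⟩ := hG (criticalProbI 3) hθ δ hδ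
  have hle' := hle n hn
  change (bondPercolation (zdGraph 3) (criticalProbI 3)).real (goodBox n) ≤ 1 - δ at hle'
  change 1 - δ < (bondPercolation (zdGraph 3) (criticalProbI 3)).real (goodBox n) at hgt
  exact absurd hle' (not_le.2 hgt)

/-- **The crux BY NAME from `PercOpenSupercrit.GoodBoxesLikelyWhenPercolating` (stmt-CriticalPhenomena-3826)**
(the sibling item stmt-3840 it is paired with is already proved, p151477). -/
theorem renormaliseFromLinearLRO_of_goodBoxesLikely (hG : PercOpenSupercrit.GoodBoxesLikelyWhenPercolating) :
    PercFiniteBoxLRO.RenormaliseFromLinearLRO :=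
  renormaliseFromLinearLRO_of_not_linearLRO_criticalProbI (not_linearLRO_criticalProbI_of_goodBoxesLikely hG)

/-! ## Registered anatomy sub-goals of the item (closed here) -/

/-- **Registered sub-goal `stub_cruxOfFreeBoxSparse` of crux stmt-CriticalPhenomena-0857 (line `registered`, lead
cycle 4)**: the crux follows from the existing item `PercNonProliferation.FreeBoxSparse` (stmt-CriticalPhenomena-4445).
Definitionally `renormaliseFromLinearLRO_of_freeBoxSparse`. -/
theorem stub_cruxOfFreeBoxSparse : Summit.CriticalPhenomena.PercolationContinuityZ3.Theses.PercNonProliferation.FreeBoxSparse → Summit.CriticalPhenomena.PercolationContinuityZ3.Theses.PercFiniteBoxLRO.RenormaliseFromLinearLRO :=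
  renormaliseFromLinearLRO_of_freeBoxSparse

/-- **Registered sub-goal `stub_cruxOfFreeBoxShattering` of crux stmt-CriticalPhenomena-0857 (line `registered`, lead
cycle 4)**: the crux follows from the existing item `PercHollowCells.FreeBoxShattering` (stmt-CriticalPhenomena-5836,
Hutchcroft's free-box shattering folklore).  Definitionally `renormaliseFromLinearLRO_of_freeBoxShattering`. -/
theorem stub_cruxOfFreeBoxShattering : Summit.CriticalPhenomena.PercolationContinuityZ3.Theses.PercHollowCells.FreeBoxShattering → Summit.CriticalPhenomena.PercolationContinuityZ3.Theses.PercFiniteBoxLRO.RenormaliseFromLinearLRO :=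
  renormaliseFromLinearLRO_of_freeBoxShattering

/-! ## R from the sub-problem's conjunct itself (appended, lead cycle 4) -/

/-- **`¬LRO_lin(p_c)` from the conjunct `θ_{ℤ³}(p_c) = 0`**: linear-scale finite-box LRO at `p_c` would give `θ(p_c) ≥ ρ > 0`
(`le_theta_of_linearLRO`).  Recorded so that the position of the crux is fully kernel-checked:
conjunct ⇒ `FreeBoxShattering` ⇒ `FreeBoxSparse` ⇒ R, and conjunct ⇒ R directly. -/
theorem not_linearLRO_criticalProbI_of_percolationContinuityZ3
    (h : Literature.Probability.Percolation.PercolationContinuityZ3) :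
    ¬ (∃ ρ : ℝ, 0 < ρ ∧ ∃ K : ℕ, ∀ n : ℕ, 1 ≤ n → ∀ x ∈ box 3 n, ∀ y ∈ box 3 n,
        ρ ≤ (bondPercolation (zdGraph 3) (criticalProbI 3)).real (openConnIn ↑(box 3 (K * n)) x y)) := by
  rintro ⟨ρ, hρ, K, hK⟩
  have hθ := le_theta_of_linearLRO (criticalProbI 3) hK
  rw [percolationContinuityZ3_iff.1 h] at hθ
  exact absurd hθ (not_le.2 hρ)

/-- **The crux BY NAME from the sub-problem's conjunct** `Literature.Probability.Percolation.PercolationContinuityZ3`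
(`θ_{ℤ³}(p_c) = 0`): R is a consequence of the statement the route is meant to prove — the honest reading of r3 for the planners
(together with `stub_cruxIffNotLinearLROAtPc`: R ⇔ ¬LRO_lin(p_c), strictly weaker than the conjunct as far as anyone can prove). -/
theorem renormaliseFromLinearLRO_of_percolationContinuityZ3
    (h : Literature.Probability.Percolation.PercolationContinuityZ3) :
    PercFiniteBoxLRO.RenormaliseFromLinearLRO :=
  renormaliseFromLinearLRO_of_not_linearLRO_criticalProbI (not_linearLRO_criticalProbI_of_percolationContinuityZ3 h)

end Summit.CriticalPhenomena.PercolationContinuityZ3.Theorems.RenormaliseFromLinearLRO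

end
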